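import Mathlib.Data.ZMod.Units
import Mathlib.GroupTheory.SpecificGroups.Cyclic
import Mathlib.Data.Nat.Squarefree
import Mathlib.FieldTheory.Finite.Basic
import HarnessLib

/-!
# CRT coordinates on `(ℤ/n)ˣ`, `n` square-free: PK-3's generator hypotheses `hord` / `hgen` / `hσψ`
# from per-prime data (cell `b2b-bsdres`, team n1011, ROUTE-1 PORT anatomy (P-KIM); ROW T-PK6-VAL
# FILE 3, seat p02 GEN 13)

HONEST FRAMING (cell `b2b-bsdres`, run/shared/lean/b2b/bsd-rank1-residual/, verbatim in every
file): the goal of the cell is to DELETE the COMBINATION-SHAPED residual classes of the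
Birch–Swinnerton-Dyer formula for ALL analytic-rank `≤ 1` elliptic curves over `ℚ` — "full BSD
formula for every rank `≤ 1` curve in class `C`" assembled STRICTLY from published theorems — so
that the rank-`≤ 1` remainder becomes exactly the CONSTRUCTION-SHAPED classes, which are TYPED
(missing-input `Prop`s), NOT attempted. This is not "finishing BSD". Team n1011 (N10/N11; ROUTE 1,
the PORT anatomy (P-KIM) of class X4 ∧ `p = 3`): research route on CONSTRUCTION-SHAPED classes;
prove what is provable now; no claim beyond stated classes; census output = EVIDENCE, never a
Literature fact; RESIDUAL-MAP marks UNCHANGED; nothing is booked by this file. TOOL THEOREMS ONLY: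
no definition, no named fact, no instance, no `sorry`.

## What

PK-3 (`MazurTateDerivative.mapRingHom_padicLift_mul_prod_deriv_eq_kuriharaNumber_smul`, Kim–Nakamura
Prop. 3.5 "primitive roots chosen to match up", Rem. 3.6) is keyed on elements
`σ_ℓ ∈ (ℤ/n)ˣ` (`ℓ : n.primeFactors`) with
* `hord : σ_ℓ ^ (ℓ − 1) = 1`,
* `hgen : ∀ a, ∃ c : ∀ ℓ, Fin (ℓ − 1), a = ∏_ℓ σ_ℓ ^ c_ℓ`,
* `hσψ : toAdd (ψ_ℓ (σ_{ℓ'} mod ℓ)) = δ_{ℓℓ'}` for the discrete logarithms `ψ`.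
THEOREM D (D4/D6/D7) outputs Galois generators `σ_q ∈ I_q` with `χ_{ℓ_q}(σ_q) = η_q`, a generator of
`(ℤ/ℓ_q)ˣ`, and `χ_{ℓ_{q'}}(σ_q) = 1` for `q' ≠ q` (inertia at `q` fixes `μ_{ℓ_{q'}}`); read in
`(ℤ/n)ˣ` (`b_q := χ_n(σ_q)`) this is exactly the PER-PRIME data below.  This file derives PK-3's three
hypotheses from it by the Chinese remainder theorem on the square-free `n`, elementwise
(no `ZMod.prodEquivPi` transport): §1 `eq_zero_of_forall_castHom_eq_zero` / `units_eq_of_forall_unitsMap_eq`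
(an element of `ℤ/n` vanishing modulo every prime of the square-free `n` vanishes); §2 ★ `hord`, ★ `hgen`,
★ `hσψ` from `hoff : ℓ ≠ ℓ' → σ_ℓ ≡ 1 (mod ℓ')` and `hcyc : zpowers (σ_ℓ mod ℓ) = (ℤ/ℓ)ˣ`; §3 the
NORMALISED discrete logarithms: for `m ∣ ℓ − 1` and a generator `η` of `(ℤ/ℓ)ˣ` there is a surjective
`ψ : (ℤ/ℓ)ˣ →* ℤ/m` with `ψ(η) = 1` (`zmodMulEquivOfGenerator`), and the family version over the primes
of `n`.  HONEST LIMITS: group theory only; closes nothing; books nothing; 0 defs / 0 facts.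

References: C.-H. Kim, K. Nakamura, JNT 210 (2020) Prop. 3.5, Rem. 3.6 [KimNakamura2020];
K. Rubin, *Euler Systems* (2000) §4.4 [Rubin2000]; design `cells/n1011/skel/T-PORT-1-PKIM.md` v0.4
(11) (p13); T-PK6-VAL FILES 1–2 (p02 GEN 13).
-/

namespace Summit.BirchSwinnertonDyer.Rank1Residual.GaloisImage.UnitsCRT

open Finset
open scoped BigOperators

variable (n : ℕ) [NeZero n]

/-! ### §1 Square-free CRT, elementwise -/

/-- **An element of `ℤ/n` (`n` square-free) that vanishes modulo every prime of `n` vanishes.**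
[folklore] -/
theorem eq_zero_of_forall_castHom_eq_zero (hn : Squarefree n) (x : ZMod n)
    (h : ∀ ℓ (hℓ : ℓ ∈ n.primeFactors), ZMod.castHom (Nat.dvd_of_mem_primeFactors hℓ) (ZMod ℓ) x = 0) :
    x = 0 := by
  have hdvd : ∀ ℓ ∈ n.primeFactors, ℓ ∣ x.val := by
    intro ℓ hℓ
    have hx := h ℓ hℓ
    rw [ZMod.castHom_apply, ZMod.cast_eq_val, ZMod.natCast_eq_zero_iff] at hx
    exact hx
  have hn' : n ∣ x.val := by
    have hprod := Finset.prod_primes_dvd _ (fun ℓ hℓ => (Nat.prime_of_mem_primeFactors hℓ).prime) hdvd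
    rwa [Nat.prod_primeFactors_of_squarefree hn] at hprod
  have hval : x.val = 0 := Nat.eq_zero_of_dvd_of_lt hn' (ZMod.val_lt _)
  exact (ZMod.val_eq_zero _).mp hval

/-- Two elements of `ℤ/n` (`n` square-free) agreeing modulo every prime of `n` are equal. [folklore] -/
theorem eq_of_forall_castHom_eq (hn : Squarefree n) (x y : ZMod n)
    (h : ∀ ℓ (hℓ : ℓ ∈ n.primeFactors), ZMod.castHom (Nat.dvd_of_mem_primeFactors hℓ) (ZMod ℓ) x =
      ZMod.castHom (Nat.dvd_of_mem_primeFactors hℓ) (ZMod ℓ) y) : x = y := by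
  rw [← sub_eq_zero]
  exact eq_zero_of_forall_castHom_eq_zero n hn _ fun ℓ hℓ => by rw [map_sub, h ℓ hℓ, sub_self]

/-- **Units of `ℤ/n` (`n` square-free) are determined by their images in the `(ℤ/ℓ)ˣ`, `ℓ ∣ n`.**
[folklore] -/
theorem units_eq_of_forall_unitsMap_eq (hn : Squarefree n) (u v : (ZMod n)ˣ)
    (h : ∀ ℓ (hℓ : ℓ ∈ n.primeFactors), ZMod.unitsMap (Nat.dvd_of_mem_primeFactors hℓ) u =
      ZMod.unitsMap (Nat.dvd_of_mem_primeFactors hℓ) v) : u = v := by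
  refine Units.ext (eq_of_forall_castHom_eq n hn _ _ fun ℓ hℓ => ?_)
  have := congrArg (fun w : (ZMod ℓ)ˣ => (w : ZMod ℓ)) (h ℓ hℓ)
  simpa [ZMod.unitsMap_def] using this

/-! ### §2 PK-3's `hord`, `hgen`, `hσψ` from per-prime data -/

section Coordinates

variable (σ : n.primeFactors → (ZMod n)ˣ)

/-- **★ `hord`**: if `σ_ℓ ≡ 1 (mod ℓ')` for every other prime `ℓ'` of the square-free `n`, then
`σ_ℓ ^ (ℓ − 1) = 1` (Fermat at `ℓ`, triviality elsewhere, CRT). [folklore] -/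
theorem pow_sub_one_eq_one (hn : Squarefree n)
    (hoff : ∀ ℓ ℓ' : n.primeFactors, ℓ ≠ ℓ' →
      ZMod.unitsMap (Nat.dvd_of_mem_primeFactors ℓ'.2) (σ ℓ) = 1)
    (ℓ : n.primeFactors) : σ ℓ ^ ((ℓ : ℕ) - 1) = 1 := by
  refine units_eq_of_forall_unitsMap_eq n hn _ _ fun ℓ' hℓ' => ?_
  rw [map_pow, map_one]
  by_cases hℓℓ' : ℓ = ⟨ℓ', hℓ'⟩
  · subst hℓℓ'
    haveI : Fact ℓ'.Prime := ⟨Nat.prime_of_mem_primeFactors hℓ'⟩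
    exact ZMod.units_pow_card_sub_one_eq_one _ _
  · rw [hoff ℓ ⟨ℓ', hℓ'⟩ hℓℓ', one_pow]

omit [NeZero n] in
/-- The image of `∏_ℓ σ_ℓ ^ c_ℓ` modulo the prime `ℓ'` is `(σ_{ℓ'} mod ℓ') ^ c_{ℓ'}`. [folklore] -/
theorem unitsMap_prod_pow_eq
    (hoff : ∀ ℓ ℓ' : n.primeFactors, ℓ ≠ ℓ' →
      ZMod.unitsMap (Nat.dvd_of_mem_primeFactors ℓ'.2) (σ ℓ) = 1)
    (c : n.primeFactors → ℕ) (ℓ' : n.primeFactors) :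
    ZMod.unitsMap (Nat.dvd_of_mem_primeFactors ℓ'.2) (∏ ℓ, σ ℓ ^ c ℓ) =
      ZMod.unitsMap (Nat.dvd_of_mem_primeFactors ℓ'.2) (σ ℓ') ^ c ℓ' := by
  rw [map_prod, Finset.prod_eq_single ℓ' (fun ℓ _ hne => by rw [map_pow, hoff ℓ ℓ' hne, one_pow])
    (fun h => absurd (Finset.mem_univ ℓ') h), map_pow]

/-- **★ `hgen`**: if moreover `σ_ℓ mod ℓ` generates `(ℤ/ℓ)ˣ` for every prime `ℓ ∣ n`, every unit of
`ℤ/n` is `∏_ℓ σ_ℓ ^ c_ℓ` with `c_ℓ < ℓ − 1` (CRT). [cite: KimNakamura2020, Rem. 3.6 (arXiv v2 p. 9)] -/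
theorem exists_eq_prod_pow (hn : Squarefree n)
    (hoff : ∀ ℓ ℓ' : n.primeFactors, ℓ ≠ ℓ' →
      ZMod.unitsMap (Nat.dvd_of_mem_primeFactors ℓ'.2) (σ ℓ) = 1)
    (hcyc : ∀ ℓ : n.primeFactors, ∀ x : (ZMod (ℓ : ℕ))ˣ,
      x ∈ Subgroup.zpowers (ZMod.unitsMap (Nat.dvd_of_mem_primeFactors ℓ.2) (σ ℓ)))
    (a : (ZMod n)ˣ) :
    ∃ c : ∀ ℓ : n.primeFactors, Fin ((ℓ : ℕ) - 1), a = ∏ ℓ, σ ℓ ^ (c ℓ : ℕ) := by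
  have hpos : ∀ ℓ : n.primeFactors, 0 < (ℓ : ℕ) - 1 := fun ℓ =>
    Nat.sub_pos_of_lt (Nat.prime_of_mem_primeFactors ℓ.2).one_lt
  -- per prime: an exponent, reduced below `ℓ − 1` by Fermat
  have key : ∀ ℓ : n.primeFactors, ∃ k : ℕ, k < (ℓ : ℕ) - 1 ∧
      ZMod.unitsMap (Nat.dvd_of_mem_primeFactors ℓ.2) a =
        ZMod.unitsMap (Nat.dvd_of_mem_primeFactors ℓ.2) (σ ℓ) ^ k := by
    intro ℓ
    obtain ⟨k, hk⟩ := (Submonoid.mem_powers_iff _ _).1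
      (((isOfFinOrder_of_finite _).mem_powers_iff_mem_zpowers).2
        (hcyc ℓ (ZMod.unitsMap (Nat.dvd_of_mem_primeFactors ℓ.2) a)))
    haveI : Fact (ℓ : ℕ).Prime := ⟨Nat.prime_of_mem_primeFactors ℓ.2⟩
    refine ⟨k % ((ℓ : ℕ) - 1), Nat.mod_lt _ (hpos ℓ), ?_⟩
    rw [← hk]
    conv_lhs => rw [← Nat.mod_add_div k ((ℓ : ℕ) - 1), pow_add, pow_mul,
      ZMod.units_pow_card_sub_one_eq_one, one_pow, mul_one]
  choose k hk hka using key
  refine ⟨fun ℓ => ⟨k ℓ, hk ℓ⟩, units_eq_of_forall_unitsMap_eq n hn _ _ fun ℓ' hℓ' => ?_⟩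
  rw [unitsMap_prod_pow_eq n σ hoff (fun ℓ => k ℓ) ⟨ℓ', hℓ'⟩]
  exact hka ⟨ℓ', hℓ'⟩

omit [NeZero n] in
/-- **★ `hσψ`**: for discrete logarithms `ψ_ℓ` NORMALISED at the generators (`ψ_ℓ(σ_ℓ mod ℓ) = 1`),
`toAdd (ψ_ℓ (σ_{ℓ'} mod ℓ)) = δ_{ℓℓ'}` — Kim–Nakamura's "primitive roots chosen to match up".
[cite: KimNakamura2020, Rem. 3.6 (arXiv v2 p. 9)] -/
theorem toAdd_apply_unitsMap_eq_ite
    (hoff : ∀ ℓ ℓ' : n.primeFactors, ℓ ≠ ℓ' →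
      ZMod.unitsMap (Nat.dvd_of_mem_primeFactors ℓ'.2) (σ ℓ) = 1)
    {M : ℕ} (ψ : (ℓ : ℕ) → (ZMod ℓ)ˣ →* Multiplicative (ZMod M))
    (hψ : ∀ ℓ : n.primeFactors, Multiplicative.toAdd
      (ψ ℓ.1 (ZMod.unitsMap (Nat.dvd_of_mem_primeFactors ℓ.2) (σ ℓ))) = 1)
    (ℓ ℓ' : n.primeFactors) :
    Multiplicative.toAdd (ψ ℓ.1 (ZMod.unitsMap (Nat.dvd_of_mem_primeFactors ℓ.2) (σ ℓ'))) =
      if ℓ = ℓ' then 1 else 0 := by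
  by_cases h : ℓ = ℓ'
  · subst h
    rw [if_pos rfl, hψ]
  · rw [if_neg h, hoff ℓ' ℓ (Ne.symm h), map_one, toAdd_one]

end Coordinates

/-! ### §3 Normalised surjective discrete logarithms -/

/-- **Surjective discrete logarithm normalised at a given generator**: for a prime `ℓ`, `m ∣ ℓ − 1` and
a generator `η` of `(ℤ/ℓ)ˣ`, there is a surjective `ψ : (ℤ/ℓ)ˣ →* ℤ/m` with `ψ(η) = 1`
(`log_η mod m`). [folklore] -/
theorem exists_surjective_unitsHom_apply_eq_one {ℓ : ℕ} (hℓ : ℓ.Prime) {m : ℕ} (hm : m ∣ ℓ - 1)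
    (η : (ZMod ℓ)ˣ) (hη : ∀ x, x ∈ Subgroup.zpowers η) :
    ∃ ψ : (ZMod ℓ)ˣ →* Multiplicative (ZMod m),
      Function.Surjective ψ ∧ Multiplicative.toAdd (ψ η) = 1 := by
  haveI : Fact ℓ.Prime := ⟨hℓ⟩
  have hcard : Nat.card (ZMod ℓ)ˣ = ℓ - 1 := by
    rw [Nat.card_eq_fintype_card, ZMod.card_units_eq_totient, Nat.totient_prime hℓ]
  let e : Multiplicative (ZMod (ℓ - 1)) ≃* (ZMod ℓ)ˣ := zmodMulEquivOfGenerator hη hcard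
  let π : Multiplicative (ZMod (ℓ - 1)) →* Multiplicative (ZMod m) :=
    (ZMod.castHom hm (ZMod m)).toAddMonoidHom.toMultiplicative
  refine ⟨π.comp e.symm.toMonoidHom, fun y => ?_, ?_⟩
  · obtain ⟨x, hx⟩ := ZMod.castHom_surjective hm (Multiplicative.toAdd y)
    refine ⟨e (Multiplicative.ofAdd x), ?_⟩
    simp only [MonoidHom.coe_comp, MulEquiv.coe_toMonoidHom, Function.comp_apply,
      MulEquiv.symm_apply_apply]
    change Multiplicative.ofAdd (ZMod.castHom hm (ZMod m) x) = y
    rw [hx, ofAdd_toAdd]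
  · simp only [MonoidHom.coe_comp, MulEquiv.coe_toMonoidHom, Function.comp_apply]
    rw [show e.symm η = Multiplicative.ofAdd 1 from zmodMulEquivOfGenerator_symm_apply_generator hη hcard]
    change ZMod.castHom hm (ZMod m) (1 : ZMod (ℓ - 1)) = 1
    rw [map_one]

omit [NeZero n] in
/-- **The family of normalised logarithms over the primes of `n`**: given generators `η_ℓ` of
`(ℤ/ℓ)ˣ` for the primes `ℓ ∣ n` with `m ∣ ℓ − 1` (Kolyvagin primes of modulus `m`), there is a family
`ψ` with every `ψ_ℓ`, `ℓ ∣ n`, surjective and `ψ_ℓ(η_ℓ) = 1` — PK-3's `ψ` matching THEOREM D's `η`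
(DICT3's `∃ ψ` witness). [cite: KimNakamura2020, Rem. 3.6 (arXiv v2 p. 9)] -/
theorem exists_family_surjective_apply_eq_one (m : ℕ)
    (hK : ∀ ℓ ∈ n.primeFactors, m ∣ ℓ - 1)
    (η : (ℓ : ℕ) → (ZMod ℓ)ˣ) (hη : ∀ ℓ ∈ n.primeFactors, ∀ x, x ∈ Subgroup.zpowers (η ℓ)) :
    ∃ ψ : (ℓ : ℕ) → (ZMod ℓ)ˣ →* Multiplicative (ZMod m),
      ∀ ℓ ∈ n.primeFactors, Function.Surjective (ψ ℓ) ∧ Multiplicative.toAdd (ψ ℓ (η ℓ)) = 1 := by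
  classical
  have key : ∀ ℓ : ℕ, ∃ ψ : (ZMod ℓ)ˣ →* Multiplicative (ZMod m),
      ℓ ∈ n.primeFactors → Function.Surjective ψ ∧ Multiplicative.toAdd (ψ (η ℓ)) = 1 := by
    intro ℓ
    by_cases hℓ : ℓ ∈ n.primeFactors
    · obtain ⟨ψ, h1, h2⟩ := exists_surjective_unitsHom_apply_eq_one (Nat.prime_of_mem_primeFactors hℓ)
        (hK ℓ hℓ) (η ℓ) (hη ℓ hℓ)
      exact ⟨ψ, fun _ => ⟨h1, h2⟩⟩
    · exact ⟨1, fun h => absurd h hℓ⟩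
  choose ψ hψ using key
  exact ⟨ψ, fun ℓ hℓ => hψ ℓ hℓ⟩

/-! ### §4 Place-indexed input (THEOREM D's `b_q = χ_n(σ_q)`, `q ∈ r`) ⟹ PK-3's `σ : n.primeFactors → (ℤ/n)ˣ` -/

section Places

variable {α : Type*} (d : Finset α) (e : d ≃ n.primeFactors) (b : α → (ZMod n)ˣ)

omit [NeZero n] in
/-- The reindexed generators `σ_ℓ := b_{e⁻¹ ℓ}` satisfy `hoff` when the `b_q` do (along the bijection
`e : d ≃ n.primeFactors` of T-PK6-VAL FILE 2 `TameLevel.exists_equiv_primeFactors_cycLevel_zero`).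
[folklore] -/
theorem hoff_of_equiv
    (hoff : ∀ q q' : d, q ≠ q' →
      ZMod.unitsMap (Nat.dvd_of_mem_primeFactors (e q').2) (b q) = 1) :
    ∀ ℓ ℓ' : n.primeFactors, ℓ ≠ ℓ' →
      ZMod.unitsMap (Nat.dvd_of_mem_primeFactors ℓ'.2) ((fun ℓ => b (e.symm ℓ)) ℓ) = 1 := by
  intro ℓ ℓ' hne
  obtain ⟨q, rfl⟩ := e.surjective ℓ
  obtain ⟨q', rfl⟩ := e.surjective ℓ'
  simp only [Equiv.symm_apply_apply]
  exact hoff q q' fun h => hne (congrArg e h)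

omit [NeZero n] in
/-- The reindexed generators satisfy `hcyc` when the `b_q` do. [folklore] -/
theorem hcyc_of_equiv
    (hcyc : ∀ q : d, ∀ x : (ZMod ((e q : n.primeFactors) : ℕ))ˣ,
      x ∈ Subgroup.zpowers (ZMod.unitsMap (Nat.dvd_of_mem_primeFactors (e q).2) (b q))) :
    ∀ ℓ : n.primeFactors, ∀ x : (ZMod (ℓ : ℕ))ˣ,
      x ∈ Subgroup.zpowers (ZMod.unitsMap (Nat.dvd_of_mem_primeFactors ℓ.2) ((fun ℓ => b (e.symm ℓ)) ℓ)) := by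
  intro ℓ
  obtain ⟨q, rfl⟩ := e.surjective ℓ
  simp only [Equiv.symm_apply_apply]
  exact hcyc q

/-- **★ PK-3's three generator hypotheses from THEOREM D's place-indexed data** (`n` square-free,
`e : d ≃ n.primeFactors`, `b_q ∈ (ℤ/n)ˣ` with `b_q ≡ 1 (mod ℓ_{q'})` for `q' ≠ q` and `b_q mod ℓ_q`
generating; `ψ` normalised at the `b_q mod ℓ_q`): for `σ_ℓ := b_{e⁻¹ ℓ}` — `hord`, `hgen`, `hσψ` in the
literal currency of `MazurTateDerivative.mapRingHom_padicLift_mul_prod_deriv_eq_kuriharaNumber_smul`.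
[cite: KimNakamura2020, Prop. 3.5 and Rem. 3.6 (arXiv v2 pp. 8–9)] -/
theorem generator_hypotheses_of_equiv (hn : Squarefree n)
    (hoff : ∀ q q' : d, q ≠ q' →
      ZMod.unitsMap (Nat.dvd_of_mem_primeFactors (e q').2) (b q) = 1)
    (hcyc : ∀ q : d, ∀ x : (ZMod ((e q : n.primeFactors) : ℕ))ˣ,
      x ∈ Subgroup.zpowers (ZMod.unitsMap (Nat.dvd_of_mem_primeFactors (e q).2) (b q)))
    {M : ℕ} (ψ : (ℓ : ℕ) → (ZMod ℓ)ˣ →* Multiplicative (ZMod M))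
    (hψ : ∀ q : d, Multiplicative.toAdd
      (ψ (e q : n.primeFactors) (ZMod.unitsMap (Nat.dvd_of_mem_primeFactors (e q).2) (b q))) = 1) :
    (∀ ℓ ℓ' : n.primeFactors, Multiplicative.toAdd
        (ψ ℓ.1 (ZMod.unitsMap (Nat.dvd_of_mem_primeFactors ℓ.2) (b (e.symm ℓ')))) =
          if ℓ = ℓ' then 1 else 0) ∧
      (∀ ℓ : n.primeFactors, b (e.symm ℓ) ^ ((ℓ : ℕ) - 1) = 1) ∧
      (∀ a : (ZMod n)ˣ, ∃ c : ∀ ℓ : n.primeFactors, Fin ((ℓ : ℕ) - 1),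
        a = ∏ ℓ, b (e.symm ℓ) ^ (c ℓ : ℕ)) := by
  have hoff' := hoff_of_equiv n d e b hoff
  have hcyc' := hcyc_of_equiv n d e b hcyc
  refine ⟨fun ℓ ℓ' => toAdd_apply_unitsMap_eq_ite n (fun ℓ => b (e.symm ℓ)) hoff' ψ (fun ℓ => ?_) ℓ ℓ',
    fun ℓ => pow_sub_one_eq_one n (fun ℓ => b (e.symm ℓ)) hn hoff' ℓ,
    fun a => exists_eq_prod_pow n (fun ℓ => b (e.symm ℓ)) hn hoff' hcyc' a⟩
  obtain ⟨q, rfl⟩ := e.surjective ℓ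
  simp only [Equiv.symm_apply_apply]
  exact hψ q

end Places

end Summit.BirchSwinnertonDyer.Rank1Residual.GaloisImage.UnitsCRT
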